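import Summits.Ventures.PercRepro.RankLevelSetDepCountGen
import Summits.Ventures.PercRepro.RankLevelSetPlaneTenPrime
import Summits.Ventures.PercRepro.RankLevelSetPlaneTen
import Summits.Ventures.PercRepro.RankLevelSetPlaneSix
import Summits.Ventures.PercRepro.RankLevelSetLocalSparse

/-!
# PercRepro — S2: THE FLAT TAIL — the sets of rank `≤ 5` of the `e`-free core counted through their closures
(p7, gen 2; sub-claim S2, the `Y`-side of the level-`5` cells)

`proofs/SUBCLAIM-S2-p7.md` R3′. The level-`5` chains bound the `Y`-count by `2^n − #{r ≤ 5} − #{spanning}` and the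
sets of rank `≤ 5` by ALL sets of `≤ 21` elements (`Σ_{j ≤ 21} C(n, j)`, which forces `n ≥ 55` for the `7/8` tail).
Counted through their closures instead, a set `X` of rank `r` is `I ∪ (X ∖ I)` for a basis `I` of `X` (`|I| = r`) with
`X ∖ I` inside `cl(I) ∖ I`, a set of `≤ f(r) − r` points (`f(r)` = the flat bound of the core at rank `r`:
`0 / 1 / 3 / 6 / 10 / 19` at `r = 0 … 5`), so
  `#{X ⊆ E : r(X) ≤ 5} ≤ C(n,5)·2^14 + C(n,4)·2^6 + C(n,3)·2^3 + C(n,2)·2 + n + 1`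
(`ncard_eRk_le_five_le_flat`), a bound that is `≤ 2^n / 2^K` from far smaller `n` (the cells `(p, d)` with `n = p + d`
below `55`). Generic form `ncard_eRk_eq_le_choose_mul_two_pow` (one rank, one flat bound). Axioms: standard.
-/

open scoped Matroid

namespace PercRepro

namespace S2

open Set ThmN

variable {α : Type}

/-- `Σ_{j ≤ k} C(m, j) ≤ 2^m` for every `k` (the terms with `j > m` vanish). -/
theorem sum_range_choose_le_two_pow (m k : ℕ) :
    ∑ j ∈ Finset.range (k + 1), m.choose j ≤ 2 ^ m := by
  rcases Nat.lt_or_ge k m with h | h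
  · calc ∑ j ∈ Finset.range (k + 1), m.choose j
        ≤ ∑ j ∈ Finset.range (m + 1), m.choose j :=
          Finset.sum_le_sum_of_subset_of_nonneg (Finset.range_mono (by omega))
            (fun _ _ _ => Nat.zero_le _)
      _ = 2 ^ m := Nat.sum_range_choose m
  · have hsplit : ∑ j ∈ Finset.range (k + 1), m.choose j =
        ∑ j ∈ Finset.range (m + 1), m.choose j + ∑ j ∈ Finset.Ico (m + 1) (k + 1), m.choose j :=
      (Finset.sum_range_add_sum_Ico _ (by omega)).symm
    have hzero : ∑ j ∈ Finset.Ico (m + 1) (k + 1), m.choose j = 0 := by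
      apply Finset.sum_eq_zero
      intro j hj
      rw [Finset.mem_Ico] at hj
      exact Nat.choose_eq_zero_of_lt (by omega)
    rw [hsplit, hzero, Nat.sum_range_choose, add_zero]

/-- **The sets of rank exactly `r`, counted through their closures**: if every set of rank `≤ r` has `≤ f` points,
`#{X ⊆ E : r(X) = r} ≤ C(n, r)·2^(f − r)` — each such `X` is `I ∪ (X ∖ I)` for a basis `I` of `X` (an `r`-subset of
`E`) with `X ∖ I ⊆ cl(I) ∖ I`, a set of `≤ f − r` points. -/
theorem ncard_eRk_eq_le_choose_mul_two_pow (M : Matroid α) [M.Finite] (r f : ℕ)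
    (hflat : ∀ X ⊆ M.E, M.eRk X ≤ r → X.ncard ≤ f) :
    {X : Set α | X ⊆ M.E ∧ M.eRk X = r}.ncard ≤ M.E.ncard.choose r * 2 ^ (f - r) := by
  classical
  set Ef := M.ground_finite.toFinset with hEf
  have hE : (Ef : Set α) = M.E := Set.Finite.coe_toFinset _
  have hEcard : Ef.card = M.E.ncard := (Set.ncard_eq_toFinset_card _ M.ground_finite).symm
  -- the `r`-subsets of `E`, as a `Finset` of `Set`s
  set 𝓑 : Finset (Set α) := (Ef.powersetCard r).image (fun s : Finset α => (s : Set α)) with h𝓑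
  have h𝓑card : 𝓑.card ≤ M.E.ncard.choose r := by
    calc 𝓑.card ≤ (Ef.powersetCard r).card := Finset.card_image_le
      _ = Ef.card.choose r := Finset.card_powersetCard r Ef
      _ = M.E.ncard.choose r := by rw [hEcard]
  have hmem𝓑 : ∀ I : Set α, I ⊆ M.E → I.ncard = r → I ∈ 𝓑 := by
    intro I hIE hI
    have hIfin : I.Finite := M.ground_finite.subset hIE
    rw [h𝓑, Finset.mem_image]
    refine ⟨hIfin.toFinset, ?_, by simp⟩
    rw [Finset.mem_powersetCard]
    refine ⟨?_, by rw [← Set.ncard_eq_toFinset_card I hIfin]; exact hI⟩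
    intro x hx
    rw [Set.Finite.mem_toFinset] at hx
    rw [hEf, Set.Finite.mem_toFinset]
    exact hIE hx
  have h𝓑ncard : ∀ I ∈ 𝓑, I.ncard = r := by
    intro I hI
    rw [h𝓑, Finset.mem_image] at hI
    obtain ⟨s, hs, rfl⟩ := hI
    rw [Finset.mem_powersetCard] at hs
    rw [Set.ncard_coe_finset]
    exact hs.2
  -- the fibres `{X : I ⊆ X ⊆ cl I}`
  have hFibfin : ∀ I : Set α, {X : Set α | I ⊆ X ∧ X ⊆ M.closure I}.Finite := fun I =>
    M.ground_finite.finite_subsets.subset (fun X hX => hX.2.trans (M.closure_subset_ground I))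
  set Tf : Finset (Set α) := 𝓑.biUnion (fun I => (hFibfin I).toFinset) with hTf
  -- every set of rank `r` lies in the fibre of a basis
  have hcover : {X : Set α | X ⊆ M.E ∧ M.eRk X = r} ⊆ (Tf : Set (Set α)) := by
    intro X hX
    obtain ⟨I, hI⟩ := M.exists_isBasis X hX.1
    have hIX : I ⊆ X := hI.subset
    have hIE : I ⊆ M.E := hIX.trans hX.1
    have hIfin : I.Finite := M.ground_finite.subset hIE
    have hIr : I.ncard = r := by
      have h := hI.encard_eq_eRk
      rw [hX.2, ← hIfin.cast_ncard_eq] at h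
      exact_mod_cast h
    rw [Finset.mem_coe, hTf, Finset.mem_biUnion]
    exact ⟨I, hmem𝓑 I hIE hIr, by
      rw [Set.Finite.mem_toFinset]
      exact ⟨hIX, hI.subset_closure⟩⟩
  -- each fibre has `≤ 2^(f − r)` members
  have hfib : ∀ I ∈ 𝓑, ((hFibfin I).toFinset).card ≤ 2 ^ (f - r) := by
    intro I hI
    have hIr : I.ncard = r := h𝓑ncard I hI
    have hIE : I ⊆ M.E := by
      rw [h𝓑, Finset.mem_image] at hI
      obtain ⟨s, hs, rfl⟩ := hI
      rw [Finset.mem_powersetCard] at hs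
      rw [← hE]; exact_mod_cast hs.1
    have hclE : M.closure I ⊆ M.E := M.closure_subset_ground I
    have hclfin : (M.closure I).Finite := M.ground_finite.subset hclE
    have hIcl : I ⊆ M.closure I := M.subset_closure I hIE
    have hclr : M.eRk (M.closure I) ≤ r := by
      rw [M.eRk_closure_eq]
      have h := M.eRk_le_encard I
      have hIfin : I.Finite := M.ground_finite.subset hIE
      rw [← hIfin.cast_ncard_eq, hIr] at h
      exact h
    have hclf : (M.closure I).ncard ≤ f := hflat _ hclE hclr
    have hdiff : (M.closure I \ I).ncard ≤ f - r := by
      have hIfin : I.Finite := M.ground_finite.subset hIE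
      rw [Set.ncard_sdiff hIcl hIfin, hIr]
      omega
    have hsub : {X : Set α | I ⊆ X ∧ X ⊆ M.closure I} ⊆
        {B : Set α | I ⊆ B ∧ B ⊆ M.closure I ∧ B.ncard ≤ M.E.ncard} := by
      intro X hX
      exact ⟨hX.1, hX.2, Set.ncard_le_ncard (hX.2.trans hclE) M.ground_finite⟩
    calc ((hFibfin I).toFinset).card
        = {X : Set α | I ⊆ X ∧ X ⊆ M.closure I}.ncard :=
          (Set.ncard_eq_toFinset_card _ (hFibfin I)).symm
      _ ≤ {B : Set α | I ⊆ B ∧ B ⊆ M.closure I ∧ B.ncard ≤ M.E.ncard}.ncard :=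
          Set.ncard_le_ncard hsub
            (M.ground_finite.finite_subsets.subset (fun B hB => hB.2.1.trans hclE))
      _ ≤ ∑ j ∈ Finset.range (M.E.ncard - r + 1), Nat.choose (f - r) j :=
          Matroid.ncard_fibre_le' hclfin hIr hdiff M.E.ncard
      _ ≤ 2 ^ (f - r) := sum_range_choose_le_two_pow _ _
  calc {X : Set α | X ⊆ M.E ∧ M.eRk X = r}.ncard
      ≤ (Tf : Set (Set α)).ncard := Set.ncard_le_ncard hcover Tf.finite_toSet
    _ = Tf.card := Set.ncard_coe_finset Tf
    _ ≤ ∑ I ∈ 𝓑, ((hFibfin I).toFinset).card := Finset.card_biUnion_le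
    _ ≤ ∑ _I ∈ 𝓑, 2 ^ (f - r) := Finset.sum_le_sum hfib
    _ = 𝓑.card * 2 ^ (f - r) := by rw [Finset.sum_const, smul_eq_mul]
    _ ≤ M.E.ncard.choose r * 2 ^ (f - r) := Nat.mul_le_mul_right _ h𝓑card

/-- The sets of rank `≤ q` are the union of the level sets `r = 0 … q`. -/
theorem ncard_eRk_le_le_sum (M : Matroid α) [M.Finite] (q : ℕ) :
    {X : Set α | X ⊆ M.E ∧ M.eRk X ≤ q}.ncard ≤
      ∑ r ∈ Finset.range (q + 1), {X : Set α | X ⊆ M.E ∧ M.eRk X = r}.ncard := by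
  classical
  have hfin : ∀ r : ℕ, {X : Set α | X ⊆ M.E ∧ M.eRk X = r}.Finite := fun r =>
    M.ground_finite.finite_subsets.subset (fun X hX => hX.1)
  have hcover : {X : Set α | X ⊆ M.E ∧ M.eRk X ≤ q} ⊆
      ((Finset.range (q + 1)).biUnion (fun r => (hfin r).toFinset) : Finset (Set α)) := by
    intro X hX
    obtain ⟨k, hk⟩ : ∃ k : ℕ, M.eRk X = (k : ℕ∞) := by
      obtain ⟨I, hI⟩ := M.exists_isBasis X hX.1
      have hIfin : I.Finite := M.ground_finite.subset (hI.subset.trans hX.1)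
      exact ⟨I.ncard, by rw [← hI.encard_eq_eRk, hIfin.cast_ncard_eq]⟩
    have hkq : k ≤ q := by
      have := hX.2
      rw [hk] at this
      exact_mod_cast this
    rw [Finset.mem_coe, Finset.mem_biUnion]
    exact ⟨k, Finset.mem_range.2 (by omega), by
      rw [Set.Finite.mem_toFinset]
      exact ⟨hX.1, hk⟩⟩
  calc {X : Set α | X ⊆ M.E ∧ M.eRk X ≤ q}.ncard
      ≤ (((Finset.range (q + 1)).biUnion (fun r => (hfin r).toFinset) : Finset (Set α)) :
          Set (Set α)).ncard := Set.ncard_le_ncard hcover (Finset.finite_toSet _)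
    _ = ((Finset.range (q + 1)).biUnion (fun r => (hfin r).toFinset)).card :=
        Set.ncard_coe_finset _
    _ ≤ ∑ r ∈ Finset.range (q + 1), ((hfin r).toFinset).card := Finset.card_biUnion_le
    _ = ∑ r ∈ Finset.range (q + 1), {X : Set α | X ⊆ M.E ∧ M.eRk X = r}.ncard := by
        apply Finset.sum_congr rfl
        intro r _
        exact (Set.ncard_eq_toFinset_card _ (hfin r)).symm

/-- **THE FLAT TAIL OF THE `e`-FREE CORE AT LEVEL `5`**: with the flat bounds `f(0…5) = 0, 1, 3, 6, 10, 19`,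
`#{X ⊆ E : r(X) ≤ 5} ≤ C(n,5)·2^14 + C(n,4)·2^6 + C(n,3)·2^3 + C(n,2)·2 + n + 1`. -/
theorem ncard_eRk_le_five_le_flat (M : Matroid α) [M.Finite]
    (hfree : ∀ e ∈ M.E, ∃ A ⊆ M.E \ {e}, e ∉ M.closure A ∧ e ∉ M.closure ((M.E \ {e}) \ A)) :
    {X : Set α | X ⊆ M.E ∧ M.eRk X ≤ 5}.ncard ≤
      M.E.ncard.choose 5 * 2 ^ 14 + M.E.ncard.choose 4 * 2 ^ 6 + M.E.ncard.choose 3 * 2 ^ 3 +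
        M.E.ncard.choose 2 * 2 + M.E.ncard + 1 := by
  have hL0 : ∀ e ∈ M.E, ¬ M.IsLoop e := not_isLoop_of_free M hfree
  have h5 : {X : Set α | X ⊆ M.E ∧ M.eRk X = (5 : ℕ)}.ncard ≤ M.E.ncard.choose 5 * 2 ^ (19 - 5) :=
    ncard_eRk_eq_le_choose_mul_two_pow M 5 19
      (fun X hX hr => ncard_le_nineteen_of_eRk_le_five_of_free M hfree hX (by exact_mod_cast hr))
  have h4 : {X : Set α | X ⊆ M.E ∧ M.eRk X = (4 : ℕ)}.ncard ≤ M.E.ncard.choose 4 * 2 ^ (10 - 4) :=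
    ncard_eRk_eq_le_choose_mul_two_pow M 4 10
      (fun X hX hr => ncard_le_ten_of_eRk_le_four_of_free M hfree hX (by exact_mod_cast hr))
  have h3 : {X : Set α | X ⊆ M.E ∧ M.eRk X = (3 : ℕ)}.ncard ≤ M.E.ncard.choose 3 * 2 ^ (6 - 3) :=
    ncard_eRk_eq_le_choose_mul_two_pow M 3 6
      (fun X hX hr => ncard_le_six_of_eRk_le_three_of_free M hfree hX (by exact_mod_cast hr))
  have h2 : {X : Set α | X ⊆ M.E ∧ M.eRk X = (2 : ℕ)}.ncard ≤ M.E.ncard.choose 2 * 2 ^ (3 - 2) :=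
    ncard_eRk_eq_le_choose_mul_two_pow M 2 3
      (fun X hX hr => by
        have := ncard_add_one_le_two_pow_of_eRk_le M hL0 hfree 2 X hX hr
        omega)
  have h1 : {X : Set α | X ⊆ M.E ∧ M.eRk X = (1 : ℕ)}.ncard ≤ M.E.ncard.choose 1 * 2 ^ (1 - 1) :=
    ncard_eRk_eq_le_choose_mul_two_pow M 1 1
      (fun X hX hr => by
        have := ncard_add_one_le_two_pow_of_eRk_le M hL0 hfree 1 X hX hr
        omega)
  have h0 : {X : Set α | X ⊆ M.E ∧ M.eRk X = (0 : ℕ)}.ncard ≤ M.E.ncard.choose 0 * 2 ^ (0 - 0) :=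
    ncard_eRk_eq_le_choose_mul_two_pow M 0 0
      (fun X hX hr => by
        have := ncard_add_one_le_two_pow_of_eRk_le M hL0 hfree 0 X hX hr
        omega)
  have hsum := ncard_eRk_le_le_sum M 5
  simp only [Finset.sum_range_succ, Finset.sum_range_zero, zero_add] at hsum
  norm_num [Nat.choose_one_right] at h5 h4 h3 h2 h1 h0
  push_cast at hsum
  omega

end S2

end PercRepro
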